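import Mathlib.Combinatorics.Matroid.Map
import Literature.Combinatorics.Matroid.RankTwoUniformRepresentability
import HarnessLib

/-!
# Representability is invariant under isomorphism and parallel extension (Oxley, *Matroid Theory*, §1.1)

Topic `Literature/Combinatorics/Matroid`, namespace `Literature.Combinatorics.Matroid`.  THEOREMS ONLY (no new
definition); reuses the tree's `vectorMatroid`, `IsRepresentable` (row g47-#11) and Mathlib's `Matroid.map` /
`Matroid.comap` / `Matroid.mapEquiv`.

Oxley defines (§1.1, p. 12) "`M` is `𝔽`-representable if `M` is *isomorphic* to the vector matroid `M[D]` of a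
matrix `D` over `𝔽`"; the tree's `IsRepresentable K M` asks for a vector representation indexed by the ground
set itself.  This file checks that the tree's notion is invariant under matroid isomorphisms onto images
(`Matroid.map` along a map injective on `E(M)`, `Matroid.mapEquiv`) — so the two readings agree — and, more
generally, under pull-backs `Matroid.comap f` (which relabel and add elements in parallel: the vector matroid of
a matrix with repeated columns, Prop. 1.1.1).

* `vectorMatroid_comap` — `(vectorMatroid K v E).comap f = vectorMatroid K (v ∘ f) (f ⁻¹' E)`;
* `vectorMatroid_map` — `(vectorMatroid K v E).map f hf = vectorMatroid K (v ∘ f⁻¹) (f '' E)` (`f⁻¹` any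
  left inverse of `f` on `E`, here `Function.invFunOn f E`);
* `IsRepresentable.comap`, `IsRepresentable.map`, `IsRepresentable.mapEquiv`, `isRepresentable_map_iff`,
  `isRepresentable_mapEquiv_iff`, `emptyOn_isRepresentable`.

## References

* [Oxley2011] J. Oxley, *Matroid Theory*, 2nd ed., Oxford Graduate Texts in Mathematics 21, OUP 2011 — §1.1
  (Prop. 1.1.1, p. 8; the definition of `𝔽`-representable, p. 12).
-/

noncomputable section

open Set Submodule

namespace Literature.Combinatorics.Matroid

variable {α β K W : Type*} [DivisionRing K] [AddCommGroup W] [Module K W]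

/-- **Pull-back of a vector matroid**: `(vectorMatroid K v E).comap f` is the vector matroid of `v ∘ f` on
`f ⁻¹' E` (elements with the same image become parallel: a matrix with repeated columns, Prop. 1.1.1).
[cite: Oxley2011, Prop. 1.1.1] -/
theorem vectorMatroid_comap (v : β → W) (E : Set β) (f : α → β) :
    (vectorMatroid K v E).comap f = vectorMatroid K (v ∘ f) (f ⁻¹' E) := by
  refine Matroid.ext_indep rfl fun I _ => ?_
  rw [Matroid.comap_indep_iff, vectorMatroid_indep_iff, vectorMatroid_indep_iff, image_subset_iff]
  constructor
  · rintro ⟨⟨hIE, hli⟩, hinj⟩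
    exact ⟨hIE, hli.comp_of_image hinj⟩
  · rintro ⟨hIE, hli⟩
    exact ⟨⟨hIE, hli.image_of_comp f v⟩, hli.injOn.of_comp⟩

/-- Pull-backs (relabelling plus parallel copies) of representable matroids are representable.
[cite: Oxley2011, Prop. 1.1.1] -/
theorem IsRepresentable.comap {N : Matroid β} (h : IsRepresentable K N) (f : α → β) :
    IsRepresentable K (N.comap f) := by
  obtain ⟨v, hv⟩ := h
  rw [← hv, vectorMatroid_comap]
  exact vectorMatroid_isRepresentable _ _

/-- **Image of a vector matroid under a map injective on `E`**: `(vectorMatroid K v E).map f hf` is the vector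
matroid of `v ∘ f⁻¹` on `f '' E`, for the left inverse `f⁻¹ = Function.invFunOn f E` (an isomorphic copy of
`M[A]` is `M[A]` with relabelled columns). [cite: Oxley2011, §1.1 (p. 12)] -/
theorem vectorMatroid_map [Nonempty α] (v : α → W) {E : Set α} {f : α → β} (hf : InjOn f E) :
    (vectorMatroid K v E).map f hf = vectorMatroid K (v ∘ Function.invFunOn f E) (f '' E) := by
  have hg : LeftInvOn (Function.invFunOn f E) f E := hf.leftInvOn_invFunOn
  refine Matroid.ext_indep rfl fun J (hJ : J ⊆ f '' E) => ?_
  rw [Matroid.map_indep_iff, vectorMatroid_indep_iff, and_iff_right hJ]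
  constructor
  · rintro ⟨I₀, hI₀, rfl⟩
    obtain ⟨hI₀E, hli⟩ := (vectorMatroid_indep_iff v E).1 hI₀
    have hli' : LinearIndepOn K ((v ∘ Function.invFunOn f E) ∘ f) I₀ :=
      (linearIndepOn_congr fun x hx => by simp [Function.comp_apply, hg (hI₀E hx)]).1 hli
    exact hli'.image_of_comp f _
  · intro hli
    have hJ' : f '' (E ∩ f ⁻¹' J) = J := by
      refine (image_subset_iff.2 fun x hx => hx.2).antisymm fun y hy => ?_
      obtain ⟨x, hxE, rfl⟩ := hJ hy
      exact ⟨x, ⟨hxE, hy⟩, rfl⟩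
    refine ⟨E ∩ f ⁻¹' J, (vectorMatroid_indep_iff v E).2 ⟨inter_subset_left, ?_⟩, hJ'.symm⟩
    rw [← hJ'] at hli
    have hli' := hli.comp_of_image (hf.mono inter_subset_left)
    exact (linearIndepOn_congr fun x hx => by simp [Function.comp_apply, hg hx.1]).2 hli'

/-- The empty matroid is representable. [cite: Oxley2011, §1.1 (p. 12)] -/
theorem emptyOn_isRepresentable (β : Type*) : IsRepresentable K (Matroid.emptyOn β) :=
  ⟨0, Matroid.ground_eq_empty_iff.1 rfl⟩

/-- **Representability is an isomorphism invariant**: the image `M.map f hf` of a representable matroid under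
a map injective on `E(M)` is representable. [cite: Oxley2011, §1.1 (p. 12)] -/
theorem IsRepresentable.map {M : Matroid α} (h : IsRepresentable K M) {f : α → β} (hf : InjOn f M.E) :
    IsRepresentable K (M.map f hf) := by
  rcases isEmpty_or_nonempty α with hα | hα
  · have hM : M = Matroid.emptyOn α := Matroid.ground_eq_empty_iff.1 (eq_empty_of_isEmpty _)
    subst hM
    rw [Matroid.map_emptyOn]
    exact emptyOn_isRepresentable β
  obtain ⟨v, hv⟩ := h
  have h' : M.map f hf = (vectorMatroid K v M.E).map f hf := by congr 1; exact hv.symm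
  rw [h', vectorMatroid_map v hf]
  exact vectorMatroid_isRepresentable _ _

/-- Representability is invariant under `Matroid.mapEquiv`. [cite: Oxley2011, §1.1 (p. 12)] -/
theorem IsRepresentable.mapEquiv {M : Matroid α} (h : IsRepresentable K M) (f : α ≃ β) :
    IsRepresentable K (M.mapEquiv f) :=
  h.map f.injective.injOn

/-- For an injective `f`, `M.map f` is representable iff `M` is. [cite: Oxley2011, §1.1 (p. 12)] -/
theorem isRepresentable_map_iff {M : Matroid α} {f : α → β} (hf : f.Injective) :
    IsRepresentable K (M.map f hf.injOn) ↔ IsRepresentable K M :=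
  ⟨fun h => by simpa [Matroid.comap_map hf] using h.comap f, fun h => h.map hf.injOn⟩

/-- `M.mapEquiv f` is representable iff `M` is (isomorphic matroids are simultaneously representable).
[cite: Oxley2011, §1.1 (p. 12)] -/
theorem isRepresentable_mapEquiv_iff {M : Matroid α} (f : α ≃ β) :
    IsRepresentable K (M.mapEquiv f) ↔ IsRepresentable K M :=
  isRepresentable_map_iff f.injective

end Literature.Combinatorics.Matroid
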